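import Summits.AtomisticToContinuum.BoseEinsteinCondensation.Theses.BECTangentRigidity

/-!
# Route `BECTangentRigidity`, support item `TransferGlue` (stmt-AtomisticToContinuum-14198)

Settles the support item `stmt-AtomisticToContinuum-14198` of route
`route-AtomisticToContinuum-BECTangentRigidity`: the **glue, by name**,

  `TransferGlue : MesoscopicFloor → RigidMomentumBound → TangentTransfer → CoarseCoherence`.

`TangentTransfer` is, for every repulsive finite-range pair potential `v`, the implication
`MesoscopicFloor(v) → RigidMomentumBound(v) → CoarseCoherence(v)` with the three bodies inlined
verbatim; `MesoscopicFloor`, `RigidMomentumBound` and `CoarseCoherence` are the corresponding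
`∀ v, IsRepulsiveFiniteRange v → …` statements. Hence the item is pure logic: for each admissible
`v` feed the two hypotheses at `v` into the transfer at `v`. The proof term is the one certified
inside the route's deciding theorem `closes`: `fun hF hS hT v hv => hT v hv (hF v hv) (hS v hv)`.

No analytic content lives here; this file is the route-facing wrapper that makes the item graph
cruxes → target (`CoarseCoherence`) → Statement explicit.

References: [LSSY2005] Lieb–Seiringer–Solovej–Yngvason, *The Mathematics of the Bose Gas and its
Condensation* (2005), §1.2 (vocabulary only).
-/

namespace Summit.AtomisticToContinuum.BoseEinsteinCondensation.Theorems

/-- **Item stmt-AtomisticToContinuum-14198** (`TransferGlue` of route `BECTangentRigidity`, exact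
route decl): `MesoscopicFloor → RigidMomentumBound → TangentTransfer → CoarseCoherence`.
After unfolding the four route definitions, `TangentTransfer v hv` is literally
`MesoscopicFloor-at-v → RigidMomentumBound-at-v → CoarseCoherence-at-v`, so the goal closes by
application. [folklore] -/
theorem becTangentRigidity_transferGlue_proof :
    Summit.AtomisticToContinuum.BoseEinsteinCondensation.Theses.BECTangentRigidity.TransferGlue := by
  unfold Theses.BECTangentRigidity.TransferGlue
  intro hF hS hT v hv
  exact hT v hv (hF v hv) (hS v hv)

end Summit.AtomisticToContinuum.BoseEinsteinCondensation.Theorems
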